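import Literature.MathematicalPhysics.QuantumFieldTheory.AbelianContourClusterExpansion
import HarnessLib

/-!
# Exponential clustering of plaquette-local observables in the low-temperature abelian lattice gauge theory on the torus

Support file for the low-temperature expansion of `ℤ_n` lattice gauge theory on the tori
`(ℤ/Lℤ)^d` (discharge of `Literature.Barriers.QuantumFields.ZnHiggsPhaseD4` through the torus core
facts of `DiscreteSubgroupFreezingProofs.lean`). The cluster-expansion bound
`AbelianContourClusterExpansion.KPRegime.norm_closedCov_le` controls the covariance of two
*multiplicative* local observables in the ensemble of *closed* plaquette configurations. This
file performs the two remaining reductions of the torus clustering theorem: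

* **general local observables** (`IsDet g B`: `g(η)` depends only on `η|_B`) are finite linear
  combinations `g = ∑_j c_j Ψ_j` of multiplicative observables local on `B` and bounded by `1`,
  with `∑_j |c_j| ≤ (2|A|)^{#B}` for `|g| ≤ 1` (`expand_eq`: expand `g` in the indicators of the
  values on `B` and each indicator `𝟙[η_p = t]` as `𝟙[η_p ∈ {0,t}] - 𝟙[η_p = 0]` resp. `𝟙[η_p = 0]`,
  all of which equal `1` at `0`); by bilinearity the closed-ensemble covariance of two such
  observables is at most `(2|A|)^{#B₁ + #B₂} · 6 #B₁ e^{6#B₁ + 2#B₂} e^{-τ D}`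
  (`KPRegime.norm_closedCov_le_of_isDet`);
* **closed versus exact configurations**: the plaquette fields of link configurations are the
  closed configurations all of whose vortices are small (`exists_plaqField_eq_of_small`) up to
  configurations carrying a vortex of size `≥ L/2`, whose weight is at most the Peierls sum
  `δ_L = ∑_{X connected, #X ≥ L/2} (|A|ε)^{#X}` times the total weight
  (`sum_closed_bigComponent_le`); hence expectations in the exact (= link, by
  `sum_comp_plaqField`) ensemble and in the closed ensemble differ by at most `4 δ_L`
  (`norm_exactAvg_sub_closedAvg_le`), and `δ_L ≤ #plaquettes · 4|A|ε · 2^{-L/2} → 0`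
  (`peierlsSum_le`, `tendsto_peierlsSum`).

The final statement `KPRegime.abs_exactCov_le` is the torus form of the exponential clustering of
the Higgs phase: for `B₁`, `B₂` separated by `≥ v - u` levels along some axis,
`|⟨g₁ g₂⟩ - ⟨g₁⟩⟨g₂⟩| ≤ (2|A|)^{#B₁+#B₂} 6 #B₁ e^{6#B₁+2#B₂} e^{-τ(v-u-1)} + 12 δ_L`.

## References

* R. Marra, S. Miracle-Solé, Comm. Math. Phys. 67 (1979) 233–240. [MarraMiraclesole1979]
* M. P. Forsström, Comm. Math. Phys. 393 (2022) 1311–1346, Thm. 1 and Rem. 7. [Forsstrom2022]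
* S. Friedli, Y. Velenik, *Statistical Mechanics of Lattice Systems* (2017), §5.7.4 (Peierls
  estimates inside convergent cluster expansions). [FriedliVelenik2017]
-/

noncomputable section

open Finset Function Filter
open Literature.Probability.LatticeModels (IsRConnected Touches GeomInc rcomponent rcomponents
  polymerPartitionFunction IsCompatible kpTerm KPTouches IsKPVolume IsPolymerCluster polymerLogZ
  truncatedWeight clusterSupp)

namespace Literature.MathematicalPhysics.QuantumFieldTheory

namespace LatticeForm

variable {d L : ℕ} [NeZero L] {A : Type*} [AddCommGroup A] [Fintype A] [DecidableEq A]

/-! ### Observables determined by the values on a plaquette set, and their expansion -/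

/-- `g` is *determined by* the values on `B`. [folklore] -/
def IsDet (g : (Plaquette d L → A) → ℂ) (B : Finset (Plaquette d L)) : Prop :=
  ∀ η η' : Plaquette d L → A, (∀ p ∈ B, η p = η' p) → g η = g η'

/-- The elementary admissible one-plaquette factors: `dfun t true = 𝟙_{{0,t}}`,
`dfun t false = 𝟙_{{0}}`; both equal `1` at `0` and take values in `{0,1}`. [folklore] -/
def dfun (t : A) (k : Bool) (x : A) : ℂ :=
  if k then (if x = 0 ∨ x = t then 1 else 0) else (if x = 0 then 1 else 0)

/-- The coefficients of the indicator `𝟙[x = t]` in the factors `dfun t k`. [folklore] -/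
def dcoef (t : A) (k : Bool) : ℂ := if k then 1 else (if t = 0 then 0 else -1)

omit [Fintype A] in
/-- `𝟙[x = t] = ∑_k dcoef t k · dfun t k x`. [folklore] -/
theorem ind_eq_sum_dcoef (t x : A) :
    (if x = t then (1 : ℂ) else 0) = ∑ k : Bool, dcoef t k * dfun t k x := by
  rw [Fintype.sum_bool]
  simp only [dcoef, dfun, if_true, Bool.false_eq_true, if_false]
  by_cases ht : t = 0
  · subst ht; by_cases hx : x = 0 <;> simp [hx]
  · by_cases hx : x = t
    · subst hx; simp [ht]
    · by_cases hx0 : x = 0 <;> simp [hx, hx0, ht, Ne.symm ht]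

omit [Fintype A] in
/-- `dfun t k 0 = 1`. [folklore] -/
@[simp] theorem dfun_zero (t : A) (k : Bool) : dfun t k 0 = 1 := by
  unfold dfun; cases k <;> simp

omit [Fintype A] in
/-- `‖dfun t k x‖ ≤ 1`. [folklore] -/
theorem norm_dfun_le (t : A) (k : Bool) (x : A) : ‖dfun t k x‖ ≤ 1 := by
  unfold dfun; split_ifs <;> simp

omit [Fintype A] in
/-- `‖dcoef t k‖ ≤ 1`. [folklore] -/
theorem norm_dcoef_le (t : A) (k : Bool) : ‖dcoef t k‖ ≤ 1 := by
  unfold dcoef; split_ifs <;> simp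

omit [Fintype A] in
/-- `dfun` is multiplicative over sums with one vanishing summand. [folklore] -/
theorem dfun_add_of_zero (t : A) (k : Bool) {x y : A} (h : x = 0 ∨ y = 0) :
    dfun t k (x + y) = dfun t k x * dfun t k y := by
  rcases h with rfl | rfl
  · rw [zero_add, dfun_zero, one_mul]
  · rw [add_zero, dfun_zero, mul_one]

/-- Extension of a value assignment on `B` by zero. [folklore] -/
def extB (B : Finset (Plaquette d L)) (u : B → A) : Plaquette d L → A :=
  fun p => if h : p ∈ B then u ⟨p, h⟩ else 0

/-- The expansion observables `Ψ_{u,κ}(η) = ∏_{p ∈ B} dfun (u p) (κ p) (η p)`. [folklore] -/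
def eobs (B : Finset (Plaquette d L)) (u : B → A) (κ : B → Bool) (η : Plaquette d L → A) : ℂ :=
  ∏ p : B, dfun (u p) (κ p) (η p)

/-- The expansion coefficients `c_{u,κ} = g(ext u) ∏_{p ∈ B} dcoef (u p) (κ p)`. [folklore] -/
def ecoef (g : (Plaquette d L → A) → ℂ) (B : Finset (Plaquette d L)) (u : B → A) (κ : B → Bool) : ℂ :=
  g (extB B u) * ∏ p : B, dcoef (u p) (κ p)

omit [NeZero L] in
/-- Step 1 of the expansion: a `B`-determined observable is the combination of the indicators of
the value assignments on `B`. [folklore] -/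
theorem eq_sum_indicator {g : (Plaquette d L → A) → ℂ} {B : Finset (Plaquette d L)} (hg : IsDet g B)
    (η : Plaquette d L → A) :
    g η = ∑ u : B → A, g (extB B u) * ∏ p : B, (if η p = u p then (1 : ℂ) else 0) := by
  classical
  set u₀ : B → A := fun p => η p with hu₀
  rw [Finset.sum_eq_single u₀]
  · have hprod : ∏ p : B, (if η p = u₀ p then (1 : ℂ) else 0) = 1 :=
      Finset.prod_eq_one fun p _ => by simp [hu₀]
    rw [hprod, mul_one]
    refine hg η (extB B u₀) fun p hp => ?_
    simp [extB, hp, hu₀]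
  · intro u _ hu
    have : ∃ p : B, η p ≠ u p := by
      by_contra hall
      push Not at hall
      exact hu (funext fun p => (hall p).symm)
    obtain ⟨p, hp⟩ := this
    rw [Finset.prod_eq_zero (Finset.mem_univ p) (by simp [hp]), mul_zero]
  · intro h; exact absurd (Finset.mem_univ u₀) h

omit [NeZero L] in
/-- **Expansion of a determined observable in multiplicative local observables**:
`g(η) = ∑_{u,κ} c_{u,κ} Ψ_{u,κ}(η)`. [folklore] -/
theorem expand_eq {g : (Plaquette d L → A) → ℂ} {B : Finset (Plaquette d L)} (hg : IsDet g B)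
    (η : Plaquette d L → A) :
    g η = ∑ u : B → A, ∑ κ : B → Bool, ecoef g B u κ * eobs B u κ η := by
  classical
  rw [eq_sum_indicator hg η]
  refine Finset.sum_congr rfl fun u _ => ?_
  have hexp : ∏ p : B, (if η p = u p then (1 : ℂ) else 0) =
      ∑ κ : B → Bool, ∏ p : B, dcoef (u p) (κ p) * dfun (u p) (κ p) (η p) :=
    calc ∏ p : B, (if η p = u p then (1 : ℂ) else 0)
        = ∏ p : B, ∑ k : Bool, dcoef (u p) k * dfun (u p) k (η p) :=
          Finset.prod_congr rfl fun p _ => ind_eq_sum_dcoef (u p) (η p)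
      _ = ∑ κ : B → Bool, ∏ p : B, dcoef (u p) (κ p) * dfun (u p) (κ p) (η p) :=
          Fintype.prod_sum (fun (p : B) (k : Bool) => dcoef (u p) k * dfun (u p) k (η p))
  rw [hexp, Finset.mul_sum]
  refine Finset.sum_congr rfl fun κ _ => ?_
  rw [Finset.prod_mul_distrib, ecoef, eobs]
  ring

omit [NeZero L] [Fintype A] in
/-- The expansion coefficients are bounded by `sup |g|`. [folklore] -/
theorem norm_ecoef_le {g : (Plaquette d L → A) → ℂ} (hg1 : ∀ η, ‖g η‖ ≤ 1) (B : Finset (Plaquette d L))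
    (u : B → A) (κ : B → Bool) : ‖ecoef g B u κ‖ ≤ 1 := by
  rw [ecoef, norm_mul]
  refine mul_le_one₀ (hg1 _) (norm_nonneg _) ?_
  rw [norm_prod]
  exact Finset.prod_le_one (fun _ _ => norm_nonneg _) fun p _ => norm_dcoef_le _ _

omit [NeZero L] [Fintype A] in
/-- The expansion observables are bounded by `1`. [folklore] -/
theorem norm_eobs_le (B : Finset (Plaquette d L)) (u : B → A) (κ : B → Bool) (η : Plaquette d L → A) :
    ‖eobs B u κ η‖ ≤ 1 := by
  rw [eobs, norm_prod]
  exact Finset.prod_le_one (fun _ _ => norm_nonneg _) fun p _ => norm_dfun_le _ _ _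

omit [Fintype A] in
/-- The expansion observables are multiplicative. [folklore] -/
theorem isMultObs_eobs (B : Finset (Plaquette d L)) (u : B → A) (κ : B → Bool) : IsMultObs (eobs B u κ) := by
  refine ⟨?_, fun η₁ η₂ hdis => ?_⟩
  · simp [eobs]
  · rw [eobs, eobs, eobs, ← Finset.prod_mul_distrib]
    refine Finset.prod_congr rfl fun p _ => ?_
    rw [Pi.add_apply]
    refine dfun_add_of_zero _ _ ?_
    by_contra h
    push Not at h
    exact Finset.disjoint_left.1 hdis (mem_psupp.2 h.1) (mem_psupp.2 h.2)

omit [Fintype A] in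
/-- The expansion observables are local on `B`. [folklore] -/
theorem isLocalOn_eobs (B : Finset (Plaquette d L)) (u : B → A) (κ : B → Bool) : IsLocalOn (eobs B u κ) B := by
  intro η hη
  rw [eobs]
  refine Finset.prod_eq_one fun p _ => ?_
  have : η p = 0 := by
    by_contra hne
    exact Finset.disjoint_left.1 hη (mem_psupp.2 hne) p.2
  rw [this, dfun_zero]

/-! ### The closed-ensemble expectation and covariance; bilinearity -/

/-- The closed-ensemble expectation `⟨f⟩_c = Z(f)/Z(1)`. [folklore] -/
def closedAvg (φ : A → ℝ) (f : (Plaquette d L → A) → ℂ) : ℂ :=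
  Zobs φ f / Zobs φ (fun _ : Plaquette d L → A => (1 : ℂ))

/-- The closed-ensemble covariance. [folklore] -/
def closedCov (φ : A → ℝ) (f g : (Plaquette d L → A) → ℂ) : ℂ :=
  closedAvg φ (fun η => f η * g η) - closedAvg φ f * closedAvg φ g

/-- `Z` is linear in the observable. [folklore] -/
theorem Zobs_sum {ι : Type*} (φ : A → ℝ) (s : Finset ι) (c : ι → ℂ) (F : ι → (Plaquette d L → A) → ℂ) :
    Zobs φ (fun η => ∑ j ∈ s, c j * F j η) = ∑ j ∈ s, c j * Zobs φ (F j) := by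
  unfold Zobs
  simp_rw [Finset.mul_sum]
  rw [Finset.sum_comm]
  refine Finset.sum_congr rfl fun j _ => Finset.sum_congr rfl fun η _ => ?_
  ring

/-- The closed-ensemble expectation is linear in the observable. [folklore] -/
theorem closedAvg_sum {ι : Type*} (φ : A → ℝ) (s : Finset ι) (c : ι → ℂ) (F : ι → (Plaquette d L → A) → ℂ) :
    closedAvg φ (fun η => ∑ j ∈ s, c j * F j η) = ∑ j ∈ s, c j * closedAvg φ (F j) := by
  unfold closedAvg
  rw [Zobs_sum, Finset.sum_div]
  refine Finset.sum_congr rfl fun j _ => ?_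
  ring

/-- **Bilinearity of the closed-ensemble covariance.** [folklore] -/
theorem closedCov_sum_sum {ι₁ ι₂ : Type*} (φ : A → ℝ) (s₁ : Finset ι₁) (s₂ : Finset ι₂)
    (c₁ : ι₁ → ℂ) (F₁ : ι₁ → (Plaquette d L → A) → ℂ) (c₂ : ι₂ → ℂ) (F₂ : ι₂ → (Plaquette d L → A) → ℂ) :
    closedCov φ (fun η => ∑ j ∈ s₁, c₁ j * F₁ j η) (fun η => ∑ k ∈ s₂, c₂ k * F₂ k η) =
      ∑ j ∈ s₁, ∑ k ∈ s₂, c₁ j * c₂ k * closedCov φ (F₁ j) (F₂ k) := by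
  unfold closedCov
  have hprod : (fun η => (∑ j ∈ s₁, c₁ j * F₁ j η) * ∑ k ∈ s₂, c₂ k * F₂ k η) =
      fun η => ∑ j ∈ s₁, c₁ j * ∑ k ∈ s₂, c₂ k * (F₁ j η * F₂ k η) := by
    funext η
    rw [Finset.sum_mul_sum]
    refine Finset.sum_congr rfl fun j _ => ?_
    rw [Finset.mul_sum]
    refine Finset.sum_congr rfl fun k _ => ?_
    ring
  rw [hprod, closedAvg_sum]
  simp_rw [closedAvg_sum]
  rw [Finset.sum_mul_sum]
  simp_rw [Finset.mul_sum, ← Finset.sum_sub_distrib]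
  refine Finset.sum_congr rfl fun j _ => Finset.sum_congr rfl fun k _ => ?_
  ring

namespace KPRegime

variable {φ : A → ℝ} {ε τ : ℝ}

/-- **Exponential clustering of determined observables in the closed-vortex ensemble.** For
`g₁` determined by `B₁`, `g₂` by `B₂`, both bounded by `1`, under the cluster-size hypothesis of
`norm_closedCov_le`:
`‖Cov_c(g₁,g₂)‖ ≤ (2|A|)^{#B₁} (2|A|)^{#B₂} · 6 #B₁ e^{6#B₁+2#B₂} e^{-τD}`. [cite: KoteckyPreiss1986, Theorem p. 492, (2), (4), (5)] -/
theorem norm_closedCov_le_of_isDet (h : KPRegime d A φ ε τ) {g₁ g₂ : (Plaquette d L → A) → ℂ}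
    {B₁ B₂ : Finset (Plaquette d L)} (hg₁ : IsDet g₁ B₁) (hg₂ : IsDet g₂ B₂)
    (hb₁ : ∀ η, ‖g₁ η‖ ≤ 1) (hb₂ : ∀ η, ‖g₂ η‖ ≤ 1) {D : ℝ} (hD0 : 0 ≤ D)
    (hD : ∀ C ∈ (connSets d L).powerset, IsPolymerCluster (GeomInc CubeAdj) C → Meets C B₂ →
      KPTouches (GeomInc CubeAdj) C B₁ → D ≤ ∑ X ∈ C, (X.card : ℝ)) :
    ‖closedCov φ g₁ g₂‖ ≤
      (2 * Fintype.card A) ^ B₁.card * (2 * Fintype.card A) ^ B₂.card *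
        (6 * B₁.card * Real.exp (6 * B₁.card + 2 * B₂.card) * Real.exp (-(τ * D))) := by
  classical
  set K := 6 * B₁.card * Real.exp (6 * B₁.card + 2 * B₂.card) * Real.exp (-(τ * D)) with hK
  have hK0 : 0 ≤ K := by rw [hK]; positivity
  -- expand both observables
  have he₁ : g₁ = fun η => ∑ j ∈ (Finset.univ : Finset ((B₁ → A) × (B₁ → Bool))),
      ecoef g₁ B₁ j.1 j.2 * eobs B₁ j.1 j.2 η := by
    funext η
    rw [expand_eq hg₁ η, ← Finset.sum_product', Finset.univ_product_univ]
  have he₂ : g₂ = fun η => ∑ k ∈ (Finset.univ : Finset ((B₂ → A) × (B₂ → Bool))),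
      ecoef g₂ B₂ k.1 k.2 * eobs B₂ k.1 k.2 η := by
    funext η
    rw [expand_eq hg₂ η, ← Finset.sum_product', Finset.univ_product_univ]
  have hpair : ∀ (j : (B₁ → A) × (B₁ → Bool)) (k : (B₂ → A) × (B₂ → Bool)),
      ‖closedCov φ (eobs B₁ j.1 j.2) (eobs B₂ k.1 k.2)‖ ≤ K := fun j k =>
    h.norm_closedCov_le (isMultObs_eobs B₁ j.1 j.2) (isMultObs_eobs B₂ k.1 k.2)
      (norm_eobs_le B₁ j.1 j.2) (norm_eobs_le B₂ k.1 k.2) (isLocalOn_eobs B₁ j.1 j.2)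
      (isLocalOn_eobs B₂ k.1 k.2) hD0 hD
  have hterm : ∀ (j : (B₁ → A) × (B₁ → Bool)) (k : (B₂ → A) × (B₂ → Bool)),
      ‖ecoef g₁ B₁ j.1 j.2 * ecoef g₂ B₂ k.1 k.2 * closedCov φ (eobs B₁ j.1 j.2) (eobs B₂ k.1 k.2)‖ ≤ K := by
    intro j k
    rw [norm_mul, norm_mul]
    have h1 := norm_ecoef_le hb₁ B₁ j.1 j.2
    have h2 := norm_ecoef_le hb₂ B₂ k.1 k.2
    have h3 := hpair j k
    have h4 : ‖ecoef g₁ B₁ j.1 j.2‖ * ‖ecoef g₂ B₂ k.1 k.2‖ ≤ 1 :=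
      mul_le_one₀ h1 (norm_nonneg _) h2
    calc ‖ecoef g₁ B₁ j.1 j.2‖ * ‖ecoef g₂ B₂ k.1 k.2‖ * ‖closedCov φ (eobs B₁ j.1 j.2) (eobs B₂ k.1 k.2)‖
        ≤ 1 * K := mul_le_mul h4 h3 (norm_nonneg _) zero_le_one
      _ = K := one_mul K
  rw [he₁, he₂, closedCov_sum_sum]
  have hsum : ‖∑ j : (B₁ → A) × (B₁ → Bool), ∑ k : (B₂ → A) × (B₂ → Bool),
      ecoef g₁ B₁ j.1 j.2 * ecoef g₂ B₂ k.1 k.2 * closedCov φ (eobs B₁ j.1 j.2) (eobs B₂ k.1 k.2)‖ ≤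
      ∑ _j : (B₁ → A) × (B₁ → Bool), ∑ _k : (B₂ → A) × (B₂ → Bool), K :=
    (norm_sum_le _ _).trans (Finset.sum_le_sum fun j _ =>
      (norm_sum_le _ _).trans (Finset.sum_le_sum fun k _ => hterm j k))
  refine hsum.trans (le_of_eq ?_)
  rw [Finset.sum_const, Finset.sum_const, Finset.card_univ, Finset.card_univ, smul_smul, nsmul_eq_mul]
  have hc₁ : (Fintype.card ((B₁ → A) × (B₁ → Bool)) : ℝ) = (2 * Fintype.card A) ^ B₁.card := by
    rw [Fintype.card_prod, Fintype.card_fun, Fintype.card_fun, Fintype.card_bool, Fintype.card_coe]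
    push_cast
    ring
  have hc₂ : (Fintype.card ((B₂ → A) × (B₂ → Bool)) : ℝ) = (2 * Fintype.card A) ^ B₂.card := by
    rw [Fintype.card_prod, Fintype.card_fun, Fintype.card_fun, Fintype.card_bool, Fintype.card_coe]
    push_cast
    ring
  push_cast
  rw [hc₁, hc₂]

end KPRegime

/-! ### The Peierls sum and its tail bound -/

/-- The **Peierls sum** `δ(λ, M) = ∑_{X connected, #X ≥ M} λ^{#X}`: the union bound for the weight of
the configurations carrying a vortex of at least `M` plaquettes (`sum_closed_bigComponent_le`).
[folklore] -/
def peierlsSum (d L : ℕ) [NeZero L] (lam : ℝ) (M : ℕ) : ℝ :=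
  ∑ X ∈ (connSets d L).filter (fun X => M ≤ X.card), lam ^ X.card

omit [Fintype A] [DecidableEq A] in
/-- `δ ≥ 0` for `λ ≥ 0`. [folklore] -/
theorem peierlsSum_nonneg {lam : ℝ} (hlam : 0 ≤ lam) (M : ℕ) : 0 ≤ peierlsSum d L lam M :=
  Finset.sum_nonneg fun _ _ => pow_nonneg hlam _

omit [Fintype A] [DecidableEq A] in
/-- **Tail bound for the Peierls sum**: `δ(λ, M) ≤ #plaquettes · 4λ · 2^{-M}` when
`(Δ+1)² (2λ) ≤ 1/2` (every connected `X` contains some plaquette `q`; for fixed `q` group the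
connected sets by size, `card_connectedFamily_le`). [folklore] -/
theorem peierlsSum_le {lam : ℝ} (hlam : 0 ≤ lam)
    (hsmall : ((cubeDeg d : ℝ) + 1) ^ 2 * (2 * lam) ≤ 1 / 2) (M : ℕ) :
    peierlsSum d L lam M ≤ Fintype.card (Plaquette d L) * (4 * lam * (1 / 2) ^ M) := by
  classical
  set S := (connSets d L).filter (fun X => M ≤ X.card) with hS
  -- every term is counted at least once by summing over a base plaquette
  have h1 : peierlsSum d L lam M ≤ ∑ q : Plaquette d L, ∑ X ∈ S.filter (fun X => q ∈ X), lam ^ X.card := by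
    unfold peierlsSum
    rw [← hS]
    calc ∑ X ∈ S, lam ^ X.card ≤ ∑ X ∈ S, ∑ q : Plaquette d L, (if q ∈ X then lam ^ X.card else 0) := by
          refine Finset.sum_le_sum fun X hX => ?_
          obtain ⟨q, hq⟩ := (mem_connSets.1 (Finset.mem_filter.1 hX).1).1
          rw [← Finset.sum_erase_add _ _ (Finset.mem_univ q)]
          simp only [hq, if_true]
          have : 0 ≤ ∑ x ∈ Finset.univ.erase q, (if x ∈ X then lam ^ X.card else 0) :=
            Finset.sum_nonneg fun x _ => by split_ifs <;> positivity
          linarith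
      _ = ∑ q : Plaquette d L, ∑ X ∈ S, (if q ∈ X then lam ^ X.card else 0) := Finset.sum_comm
      _ = ∑ q : Plaquette d L, ∑ X ∈ S.filter (fun X => q ∈ X), lam ^ X.card :=
          Finset.sum_congr rfl fun q _ => (Finset.sum_filter (fun X => q ∈ X) _).symm
  refine h1.trans ?_
  -- for a fixed plaquette, the lattice-animal bound with `λ' = 2λ`
  have h2 : ∀ q : Plaquette d L, ∑ X ∈ S.filter (fun X => q ∈ X), lam ^ X.card ≤ 4 * lam * (1 / 2) ^ M := by
    intro q
    have hΔ : ∀ p : Plaquette d L, (cubeNbr p).card ≤ cubeDeg d := fun p => card_cubeNbr_le p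
    have hanimal := Literature.Probability.LatticeModels.sum_pow_card_le_of_connected (R := CubeAdj)
      (nbr := cubeNbr) (Δ := cubeDeg d) (fun _ _ => cubeAdj_symm) hΔ (fun _ _ h => mem_cubeNbr_of_cubeAdj h)
      (lam := 2 * lam) (by linarith) hsmall q (S.filter fun X => q ∈ X) (fun Y hY => by
        rw [Finset.mem_filter] at hY
        exact ⟨hY.2, mem_connSets.1 (Finset.mem_filter.1 hY.1).1⟩)
    calc ∑ X ∈ S.filter (fun X => q ∈ X), lam ^ X.card
        ≤ ∑ X ∈ S.filter (fun X => q ∈ X), (2 * lam) ^ X.card * (1 / 2) ^ M := by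
          refine Finset.sum_le_sum fun X hX => ?_
          have hM : M ≤ X.card := (Finset.mem_filter.1 (Finset.mem_filter.1 hX).1).2
          calc lam ^ X.card = (2 * lam) ^ X.card * (1 / 2) ^ X.card := by
                rw [← mul_pow]; ring_nf
            _ ≤ (2 * lam) ^ X.card * (1 / 2) ^ M :=
                mul_le_mul_of_nonneg_left (pow_le_pow_of_le_one (by norm_num) (by norm_num) hM)
                  (pow_nonneg (by linarith) _)
      _ = (∑ X ∈ S.filter (fun X => q ∈ X), (2 * lam) ^ X.card) * (1 / 2) ^ M := by
          rw [Finset.sum_mul]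
      _ ≤ 2 * (2 * lam) * (1 / 2) ^ M := mul_le_mul_of_nonneg_right hanimal (by positivity)
      _ = 4 * lam * (1 / 2) ^ M := by ring
  calc ∑ q : Plaquette d L, ∑ X ∈ S.filter (fun X => q ∈ X), lam ^ X.card
      ≤ ∑ _q : Plaquette d L, 4 * lam * (1 / 2) ^ M := Finset.sum_le_sum fun q _ => h2 q
    _ = Fintype.card (Plaquette d L) * (4 * lam * (1 / 2) ^ M) := by
        rw [Finset.sum_const, Finset.card_univ, nsmul_eq_mul]

omit [Fintype A] [DecidableEq A] in
/-- The number of plaquettes of the torus is at most `d² L^d`. [folklore] -/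
theorem card_plaquette_le : Fintype.card (Plaquette d L) ≤ d ^ 2 * L ^ d := by
  rw [Fintype.card_prod, Fintype.card_fun, ZMod.card, Fintype.card_fin, mul_comm]
  refine Nat.mul_le_mul_right _ ?_
  calc Fintype.card {p : Fin d × Fin d // p.1 < p.2} ≤ Fintype.card (Fin d × Fin d) :=
        Fintype.card_subtype_le _
    _ = d ^ 2 := by rw [Fintype.card_prod, Fintype.card_fin, sq]

end LatticeForm

/-! ### Exact versus closed configurations -/

section Exact

open LatticeForm

variable {d L : ℕ} [NeZero L] {G : Type*} [CommGroup G] [Fintype G] [DecidableEq G]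

/-- The *exact* plaquette configurations: the plaquette fields of the link configurations. [folklore] -/
def Img (d L : ℕ) [NeZero L] (G : Type*) [CommGroup G] [Fintype G] [DecidableEq G] :
    Finset (Plaquette d L → Additive G) :=
  Finset.univ.image (plaqField (d := d) (L := L) (G := G))

/-- The expectation in the exact (= link) ensemble: `⟨f⟩ = ∑_{η exact} Wt(η) f(η) / ∑_{η exact} Wt(η)`.
[folklore] -/
def exactAvg (φ : Additive G → ℝ) (f : (Plaquette d L → Additive G) → ℂ) : ℂ :=
  (∑ η ∈ Img d L G, (Wt φ η : ℂ) * f η) / ∑ η ∈ Img d L G, (Wt φ η : ℂ)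

/-- Exact configurations are closed (Bianchi identity). [folklore] -/
theorem Img_subset_Closed : Img d L G ⊆ Closed d L (Additive G) := by
  intro η hη
  obtain ⟨U, -, rfl⟩ := Finset.mem_image.1 hη
  exact mem_Closed.2 (isClosedPl_plaqField U)

/-- **Closed but not exact configurations carry a large vortex**: a closed configuration all of
whose cube-connected components have fewer than `L/2` plaquettes is exact
(`exists_plaqField_eq_of_small`). [folklore] -/
theorem exists_big_of_not_mem_Img (hd : 3 ≤ d) {η : Plaquette d L → Additive G} (hη : IsClosedPl η)
    (hnot : η ∉ Img d L G) : ∃ C ∈ rcomponents CubeAdj (psupp η), L / 2 ≤ C.card := by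
  by_contra hall
  push Not at hall
  obtain ⟨U, hU⟩ := exists_plaqField_eq_of_small hd hη fun C hC => by
    have := hall C hC; omega
  exact hnot (Finset.mem_image.2 ⟨U, Finset.mem_univ _, hU⟩)

/-- The exact-ensemble expectation of a real observable. [folklore] -/
def exactAvgR (φ : Additive G → ℝ) (f : (Plaquette d L → Additive G) → ℝ) : ℝ :=
  (∑ η ∈ Img d L G, Wt φ η * f η) / ∑ η ∈ Img d L G, Wt φ η

/-- The complex expectation of a real observable is its real expectation. [folklore] -/
theorem exactAvg_ofReal (φ : Additive G → ℝ) (f : (Plaquette d L → Additive G) → ℝ) :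
    exactAvg φ (fun η => (f η : ℂ)) = (exactAvgR φ f : ℂ) := by
  rw [exactAvg, exactAvgR]; push_cast; rfl

/-- **Link-ensemble expectations of functions of the plaquette field are exact-ensemble
expectations**: `(∑_U f(ω_U) w(U)) / ∑_U w(U) = ⟨f⟩_exact` when `w(U) = Wt(ω_U)` (all fibres of
`U ↦ ω_U` have the same size, `sum_comp_plaqField`). [folklore] -/
theorem gibbsAverage_eq_exactAvgR (φ : Additive G → ℝ) {w : GaugeConfig d L G → ℝ}
    (hw : ∀ U, w U = Wt φ (plaqField U)) (f : (Plaquette d L → Additive G) → ℝ) :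
    (∑ U : GaugeConfig d L G, f (plaqField U) * w U) / ∑ U : GaugeConfig d L G, w U = exactAvgR φ f := by
  classical
  set K := (Finset.univ.filter fun U : GaugeConfig d L G => plaqField U = 0).card with hK
  have hKpos : (0 : ℝ) < K := by exact_mod_cast card_filter_plaqField_zero_pos (d := d) (L := L) (G := G)
  have hnum : ∑ U : GaugeConfig d L G, f (plaqField U) * w U = K * ∑ η ∈ Img d L G, Wt φ η * f η := by
    simp_rw [hw]
    rw [sum_comp_plaqField (fun η => f η * Wt φ η), nsmul_eq_mul]
    unfold Img
    congr 1
    exact Finset.sum_congr rfl fun η _ => mul_comm _ _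
  have hden : ∑ U : GaugeConfig d L G, w U = K * ∑ η ∈ Img d L G, Wt φ η := by
    simp_rw [hw]
    rw [sum_comp_plaqField (fun η => Wt φ η), nsmul_eq_mul]
    rfl
  rw [hnum, hden, mul_div_mul_left _ _ hKpos.ne', exactAvgR]

/-- **Exact and closed expectations agree up to the Peierls error**: for `|f| ≤ 1`, weights in
`[0, ε]` off `0` with `φ 0 = 1`, and `δ = δ(|A|ε, L/2) ≤ 1/2`,
`‖⟨f⟩_exact - ⟨f⟩_closed‖ ≤ 4δ`. [cite: FriedliVelenik2017, §5.7.4 (Peierls estimates within the cluster expansion)] -/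
theorem norm_exactAvg_sub_closedAvg_le (hd : 3 ≤ d) {φ : Additive G → ℝ} (hφ0 : φ 0 = 1)
    (hφ : ∀ a, 0 ≤ φ a) {ε : ℝ} (hε0 : 0 ≤ ε) (hε : ∀ a, a ≠ 0 → φ a ≤ ε)
    (f : (Plaquette d L → Additive G) → ℂ) (hf : ∀ η, ‖f η‖ ≤ 1)
    (hδ : peierlsSum d L ((Fintype.card (Additive G) : ℝ) * ε) (L / 2) ≤ 1 / 2) :
    ‖exactAvg φ f - closedAvg φ f‖ ≤ 4 * peierlsSum d L ((Fintype.card (Additive G) : ℝ) * ε) (L / 2) := by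
  have hWt0 : ∀ η : Plaquette d L → Additive G, 0 ≤ Wt φ η := fun η => Wt_nonneg hφ η
  have hsub : Img d L G ⊆ Closed d L (Additive G) := Img_subset_Closed
  -- the difference set carries a big vortex: Peierls
  haveI : DecidablePred fun η : Plaquette d L → Additive G =>
      ∃ C ∈ rcomponents CubeAdj (psupp η), L / 2 ≤ C.card := fun _ => Classical.propDecidable _
  have hdiff : ∑ η ∈ Closed d L (Additive G) \ Img d L G, Wt φ η ≤
      (∑ η ∈ Closed d L (Additive G), Wt φ η) * peierlsSum d L ((Fintype.card (Additive G) : ℝ) * ε) (L / 2) := by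
    calc ∑ η ∈ Closed d L (Additive G) \ Img d L G, Wt φ η
        ≤ ∑ η ∈ (Closed d L (Additive G)).filter
            (fun η => ∃ C ∈ rcomponents CubeAdj (psupp η), L / 2 ≤ C.card), Wt φ η := by
          refine Finset.sum_le_sum_of_subset_of_nonneg (fun η hη => ?_) fun η _ _ => hWt0 η
          rw [Finset.mem_sdiff] at hη
          exact Finset.mem_filter.2 ⟨hη.1, exists_big_of_not_mem_Img hd (mem_Closed.1 hη.1) hη.2⟩
      _ ≤ _ := sum_closed_bigComponent_le hφ0 hφ hε0 hε (L / 2)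
  have hZsplit : ∑ η ∈ Closed d L (Additive G), Wt φ η =
      ∑ η ∈ Img d L G, Wt φ η + ∑ η ∈ Closed d L (Additive G) \ Img d L G, Wt φ η := by
    rw [← Finset.sum_sdiff hsub, add_comm]
  have hNsplit : ∑ η ∈ Closed d L (Additive G), (Wt φ η : ℂ) * f η =
      ∑ η ∈ Img d L G, (Wt φ η : ℂ) * f η + ∑ η ∈ Closed d L (Additive G) \ Img d L G, (Wt φ η : ℂ) * f η := by
    rw [← Finset.sum_sdiff hsub, add_comm]
  have hS0 : 0 ≤ ∑ η ∈ Closed d L (Additive G) \ Img d L G, Wt φ η := Finset.sum_nonneg fun η _ => hWt0 η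
  have hE : exactAvg φ f = (∑ η ∈ Img d L G, (Wt φ η : ℂ) * f η) / ((∑ η ∈ Img d L G, Wt φ η : ℝ) : ℂ) := by
    rw [exactAvg]; push_cast; rfl
  have hC : closedAvg φ f = (∑ η ∈ Closed d L (Additive G), (Wt φ η : ℂ) * f η) /
      ((∑ η ∈ Closed d L (Additive G), Wt φ η : ℝ) : ℂ) := by
    rw [closedAvg, Zobs, Zobs]; push_cast
    congr 1
    exact Finset.sum_congr rfl fun η _ => mul_one _
  have hZc_pos : 0 < ∑ η ∈ Closed d L (Additive G), Wt φ η := by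
    have h0 : (0 : Plaquette d L → Additive G) ∈ Closed d L (Additive G) := mem_Closed.2 isClosedPl_zero
    have hW0 : Wt φ (0 : Plaquette d L → Additive G) = 1 := by simp [Wt, hφ0]
    calc (0 : ℝ) < 1 := one_pos
      _ = Wt φ (0 : Plaquette d L → Additive G) := hW0.symm
      _ ≤ _ := Finset.single_le_sum (fun η _ => hWt0 η) h0
  have hNdiff' : ‖∑ η ∈ Closed d L (Additive G) \ Img d L G, (Wt φ η : ℂ) * f η‖ ≤
      ∑ η ∈ Closed d L (Additive G) \ Img d L G, Wt φ η := by
    refine (norm_sum_le _ _).trans (Finset.sum_le_sum fun η _ => ?_)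
    rw [norm_mul, Complex.norm_real, Real.norm_eq_abs, abs_of_nonneg (hWt0 η)]
    exact mul_le_of_le_one_right (hWt0 η) (hf η)
  have hNc_le' : ‖∑ η ∈ Closed d L (Additive G), (Wt φ η : ℂ) * f η‖ ≤ ∑ η ∈ Closed d L (Additive G), Wt φ η := by
    refine (norm_sum_le _ _).trans (Finset.sum_le_sum fun η _ => ?_)
    rw [norm_mul, Complex.norm_real, Real.norm_eq_abs, abs_of_nonneg (hWt0 η)]
    exact mul_le_of_le_one_right (hWt0 η) (hf η)
  rw [hE, hC]
  -- now generalize the four sums and the Peierls sum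
  generalize hδg : peierlsSum d L ((Fintype.card (Additive G) : ℝ) * ε) (L / 2) = δ at hδ hdiff ⊢
  generalize ∑ η ∈ Closed d L (Additive G), Wt φ η = Zc at hdiff hZsplit hZc_pos hNc_le' ⊢
  generalize ∑ η ∈ Img d L G, Wt φ η = Ze at hZsplit ⊢
  generalize ∑ η ∈ Closed d L (Additive G), (Wt φ η : ℂ) * f η = Nc at hNsplit hNc_le' ⊢
  generalize ∑ η ∈ Img d L G, (Wt φ η : ℂ) * f η = Ne at hNsplit ⊢
  generalize ∑ η ∈ Closed d L (Additive G) \ Img d L G, Wt φ η = S at hdiff hZsplit hS0 hNdiff' ⊢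
  generalize ∑ η ∈ Closed d L (Additive G) \ Img d L G, (Wt φ η : ℂ) * f η = T at hNsplit hNdiff' ⊢
  -- real arithmetic
  have hδ0 : 0 ≤ δ := by
    rw [← hδg]; exact peierlsSum_nonneg (by positivity) _
  have hZe_ge : Zc / 2 ≤ Ze := by nlinarith
  have hZe_pos : 0 < Ze := by linarith
  have hNdiff : ‖Nc - Ne‖ ≤ Zc * δ := by
    rw [hNsplit, add_sub_cancel_left]; exact hNdiff'.trans hdiff
  have hZeC : (Ze : ℂ) ≠ 0 := by exact_mod_cast hZe_pos.ne'
  have hZcC : (Zc : ℂ) ≠ 0 := by exact_mod_cast hZc_pos.ne'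
  rw [div_sub_div _ _ hZeC hZcC, norm_div, norm_mul, Complex.norm_real, Complex.norm_real,
    Real.norm_eq_abs, Real.norm_eq_abs, abs_of_pos hZe_pos, abs_of_pos hZc_pos,
    div_le_iff₀ (mul_pos hZe_pos hZc_pos)]
  have hnum : ‖Ne * (Zc : ℂ) - (Ze : ℂ) * Nc‖ ≤ 2 * δ * Zc * Zc := by
    have hrw : Ne * (Zc : ℂ) - (Ze : ℂ) * Nc = (Ne - Nc) * (Zc : ℂ) + Nc * ((Zc - Ze : ℝ) : ℂ) := by
      push_cast; ring
    rw [hrw]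
    refine (norm_add_le _ _).trans ?_
    rw [norm_mul, norm_mul, Complex.norm_real, Real.norm_eq_abs, abs_of_pos hZc_pos, norm_sub_rev,
      Complex.norm_real, Real.norm_eq_abs, abs_of_nonneg (by linarith)]
    have h1 : ‖Nc - Ne‖ * Zc ≤ Zc * δ * Zc := mul_le_mul_of_nonneg_right hNdiff hZc_pos.le
    have h2 : ‖Nc‖ * (Zc - Ze) ≤ Zc * (Zc * δ) :=
      mul_le_mul hNc_le' (by linarith) (by linarith) hZc_pos.le
    linarith
  refine hnum.trans ?_
  have h3 : 2 * δ * Zc * Zc ≤ 2 * δ * (2 * Ze) * Zc :=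
    mul_le_mul_of_nonneg_right (mul_le_mul_of_nonneg_left (by linarith) (by positivity)) hZc_pos.le
  linarith

/-- Expectations in the closed ensemble of observables bounded by `1` are bounded by `1`. [folklore] -/
theorem norm_closedAvg_le {φ : Additive G → ℝ} (hφ0 : φ 0 = 1) (hφ : ∀ a, 0 ≤ φ a)
    (f : (Plaquette d L → Additive G) → ℂ) (hf : ∀ η, ‖f η‖ ≤ 1) : ‖closedAvg φ f‖ ≤ 1 := by
  classical
  have hWt0 : ∀ η : Plaquette d L → Additive G, 0 ≤ Wt φ η := fun η => Wt_nonneg hφ η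
  set Zc : ℝ := ∑ η ∈ Closed d L (Additive G), Wt φ η with hZc
  have hZc_pos : 0 < Zc := by
    have h0 : (0 : Plaquette d L → Additive G) ∈ Closed d L (Additive G) := mem_Closed.2 isClosedPl_zero
    have hW0 : Wt φ (0 : Plaquette d L → Additive G) = 1 := by simp [Wt, hφ0]
    calc (0 : ℝ) < 1 := one_pos
      _ = Wt φ (0 : Plaquette d L → Additive G) := hW0.symm
      _ ≤ Zc := Finset.single_le_sum (fun η _ => hWt0 η) h0
  have hden : Zobs φ (fun _ : Plaquette d L → Additive G => (1 : ℂ)) = (Zc : ℂ) := by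
    rw [Zobs, hZc]; push_cast
    exact Finset.sum_congr rfl fun η _ => mul_one _
  rw [closedAvg, hden, norm_div, Complex.norm_real, Real.norm_eq_abs, abs_of_pos hZc_pos,
    div_le_one hZc_pos, Zobs]
  refine (norm_sum_le _ _).trans (Finset.sum_le_sum fun η _ => ?_)
  rw [norm_mul, Complex.norm_real, Real.norm_eq_abs, abs_of_nonneg (hWt0 η)]
  exact mul_le_of_le_one_right (hWt0 η) (hf η)

/-- Expectations in the exact ensemble of observables bounded by `1` are bounded by `1`. [folklore] -/
theorem norm_exactAvg_le {φ : Additive G → ℝ} (hφ0 : φ 0 = 1) (hφ : ∀ a, 0 ≤ φ a)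
    (f : (Plaquette d L → Additive G) → ℂ) (hf : ∀ η, ‖f η‖ ≤ 1) : ‖exactAvg φ f‖ ≤ 1 := by
  classical
  have hWt0 : ∀ η : Plaquette d L → Additive G, 0 ≤ Wt φ η := fun η => Wt_nonneg hφ η
  set Ze : ℝ := ∑ η ∈ Img d L G, Wt φ η with hZe
  have hZe_pos : 0 < Ze := by
    have h0 : (0 : Plaquette d L → Additive G) ∈ Img d L G :=
      Finset.mem_image.2 ⟨1, Finset.mem_univ _, plaqField_one⟩
    have hW0 : Wt φ (0 : Plaquette d L → Additive G) = 1 := by simp [Wt, hφ0]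
    calc (0 : ℝ) < 1 := one_pos
      _ = Wt φ (0 : Plaquette d L → Additive G) := hW0.symm
      _ ≤ Ze := Finset.single_le_sum (fun η _ => hWt0 η) h0
  have hden : ∑ η ∈ Img d L G, (Wt φ η : ℂ) = (Ze : ℂ) := by rw [hZe]; push_cast; rfl
  rw [exactAvg, hden, norm_div, Complex.norm_real, Real.norm_eq_abs, abs_of_pos hZe_pos,
    div_le_one hZe_pos]
  refine (norm_sum_le _ _).trans (Finset.sum_le_sum fun η _ => ?_)
  rw [norm_mul, Complex.norm_real, Real.norm_eq_abs, abs_of_nonneg (hWt0 η)]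
  exact mul_le_of_le_one_right (hWt0 η) (hf η)

/-- **Exponential clustering on the torus, exact (link) ensemble.** In the KP regime, for
observables `g₁, g₂` determined by `B₁, B₂` and bounded by `1`, separated along the axis `m`
(levels of `B₁` at most `u`, levels of `B₂` at least `v`, relative to the residue `c`), and with
the Peierls error `δ = δ(|A|ε, L/2) ≤ 1/2`:
`‖⟨g₁g₂⟩ - ⟨g₁⟩⟨g₂⟩‖ ≤ (2|A|)^{#B₁}(2|A|)^{#B₂} 6#B₁ e^{6#B₁+2#B₂} e^{-τ(v-u-1)} + 12 δ`
(cluster expansion in the closed-vortex ensemble, `norm_closedCov_le_of_isDet` with the geometric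
input `le_sum_card_of_cluster_meets`, plus three exact-versus-closed comparisons).
[cite: Forsstrom2022, Theorem 1 and Remark 7 (free/periodic boundary conditions)] -/
theorem LatticeForm.KPRegime.norm_exactCov_le (hd : 3 ≤ d) {φ : Additive G → ℝ} {ε τ : ℝ}
    (h : KPRegime d (Additive G) φ ε τ) {g₁ g₂ : (Plaquette d L → Additive G) → ℂ}
    {B₁ B₂ : Finset (Plaquette d L)} (hg₁ : IsDet g₁ B₁) (hg₂ : IsDet g₂ B₂)
    (hb₁ : ∀ η, ‖g₁ η‖ ≤ 1) (hb₂ : ∀ η, ‖g₂ η‖ ≤ 1) (m : Fin d) (c : ZMod L) {u v : ℕ}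
    (hB₁ : ∀ b ∈ B₁, torusLevel m c b ≤ u) (hB₂ : ∀ b ∈ B₂, v ≤ torusLevel m c b) (huv : u + 1 ≤ v)
    (hδ : peierlsSum d L ((Fintype.card (Additive G) : ℝ) * ε) (L / 2) ≤ 1 / 2) :
    ‖exactAvg φ (fun η => g₁ η * g₂ η) - exactAvg φ g₁ * exactAvg φ g₂‖ ≤
      (2 * Fintype.card (Additive G)) ^ B₁.card * (2 * Fintype.card (Additive G)) ^ B₂.card *
          (6 * B₁.card * Real.exp (6 * B₁.card + 2 * B₂.card) * Real.exp (-(τ * ((v : ℝ) - u - 1)))) +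
        12 * peierlsSum d L ((Fintype.card (Additive G) : ℝ) * ε) (L / 2) := by
  set δ := peierlsSum d L ((Fintype.card (Additive G) : ℝ) * ε) (L / 2) with hδdef
  -- closed-ensemble clustering
  have hD0 : (0 : ℝ) ≤ (v : ℝ) - u - 1 := by
    have : ((u + 1 : ℕ) : ℝ) ≤ v := by exact_mod_cast huv
    push_cast at this; linarith
  have hclosed := h.norm_closedCov_le_of_isDet hg₁ hg₂ hb₁ hb₂ hD0 (fun C hC hcl h2 h1 =>
    le_sum_card_of_cluster_meets hC hcl m c hB₁ hB₂ h2 h1)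
  -- three comparisons exact/closed
  have hb₁₂ : ∀ η, ‖g₁ η * g₂ η‖ ≤ 1 := fun η => by
    rw [norm_mul]; exact mul_le_one₀ (hb₁ η) (norm_nonneg _) (hb₂ η)
  have e₁₂ := norm_exactAvg_sub_closedAvg_le hd h.zero h.nonneg h.eps_nonneg h.le_eps _ hb₁₂ hδ
  have e₁ := norm_exactAvg_sub_closedAvg_le hd h.zero h.nonneg h.eps_nonneg h.le_eps _ hb₁ hδ
  have e₂ := norm_exactAvg_sub_closedAvg_le hd h.zero h.nonneg h.eps_nonneg h.le_eps _ hb₂ hδ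
  have c₁ := norm_closedAvg_le h.zero h.nonneg g₁ hb₁
  have c₂ := norm_closedAvg_le h.zero h.nonneg g₂ hb₂
  have hδ0 : 0 ≤ δ := peierlsSum_nonneg (mul_nonneg (Nat.cast_nonneg _) h.eps_nonneg) _
  have x₂ : ‖exactAvg φ g₂‖ ≤ 1 := norm_exactAvg_le h.zero h.nonneg g₂ hb₂
  -- algebra
  set X := closedCov φ g₁ g₂ with hX
  set Y := exactAvg φ (fun η => g₁ η * g₂ η) - closedAvg φ (fun η => g₁ η * g₂ η) with hY
  set Z := (exactAvg φ g₁ - closedAvg φ g₁) * exactAvg φ g₂ with hZ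
  set W := closedAvg φ g₁ * (exactAvg φ g₂ - closedAvg φ g₂) with hW
  have key : exactAvg φ (fun η => g₁ η * g₂ η) - exactAvg φ g₁ * exactAvg φ g₂ = X + Y - Z - W := by
    rw [hX, hY, hZ, hW]; unfold closedCov; ring
  rw [key]
  have t1 : ‖Z‖ ≤ 4 * δ * 1 := by
    rw [hZ, norm_mul]; exact mul_le_mul e₁ x₂ (norm_nonneg _) (by positivity)
  have t2 : ‖W‖ ≤ 1 * (4 * δ) := by
    rw [hW, norm_mul]; exact mul_le_mul c₁ e₂ (norm_nonneg _) zero_le_one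
  have n1 : ‖X + Y - Z - W‖ ≤ ‖X + Y - Z‖ + ‖W‖ := norm_sub_le _ _
  have n2 : ‖X + Y - Z‖ ≤ ‖X + Y‖ + ‖Z‖ := norm_sub_le _ _
  have n3 : ‖X + Y‖ ≤ ‖X‖ + ‖Y‖ := norm_add_le _ _
  have hYb : ‖Y‖ ≤ 4 * δ := e₁₂
  linarith

end Exact

end Literature.MathematicalPhysics.QuantumFieldTheory

end
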